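import Mathlib
import Summits.NavierStokesRegularity.NavierStokesRegularity.Theorems.FilamentSkeletonRssDefectColumnGateAzimuthalBlockCoreCurrencies
import Summits.NavierStokesRegularity.NavierStokesRegularity.Theorems.FilamentSkeletonRssDefectColumnGateAzimuthalBlockLayerChoice
import Summits.NavierStokesRegularity.NavierStokesRegularity.Theorems.FilamentSkeletonRssDefectColumnGateAzimuthalBlockExteriorPackage
import Summits.NavierStokesRegularity.NavierStokesRegularity.Theorems.FilamentSkeletonRssDefectColumnGateAzimuthalBlockExteriorFeed
import Summits.NavierStokesRegularity.NavierStokesRegularity.Theorems.FilamentSkeletonRssDefectColumnGateAzimuthalBlockTwoZonePrelim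

/-!
# Route `FilamentSkeletonRss` · crux `TransverseReduction1AG` (stmt-NavierStokesRegularity-27853; A1L twin stmt-23297) · line
# `defect_column_gate_1AG/1AL` — the TWO-ZONE a-priori bound for the Biot–Savart-coupled azimuthal blocks `m ≥ 2` of S2a-loc
# `WaistColumnGateLoc1A` (symmetric column): Gaussian core `[0, u₁]`, `u₁ ∈ [u₀ + 1/γ, u₀ + 2/γ]`, plus V-blind exterior `[u₀, ∞)`, assembled

Helper file (`--supports stmt-NavierStokesRegularity-27853 --as helper`; seat ns-filament-s2aloc-p1 g2; note ARCHITECTURE-B2B3-s2aloc-g2.md v4 §7c —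
this file IS the stage-3 plumbing).  Ingredients (all landed): `exterior_package` (p678328), `exterior_feed_le` (p675877), `layer_flux_choice` (p677610),
`coreTrunc_sup_sq_le` (p676536), `coreTrunc_currencies_le` (p677917), `sq_le_extraction_short` (p675726), `bootstrap_closure` (p678004).

`twoZone_sup_le`.  INPUT: the coupled block (OU + rotation `m(ρ+RcΩ)` + column term) LEAD-style on `(0,∞)` with support `[0,U]`, forcing
`(1+u)²|f_i| ≤ M`, stream-source size `u|a|, u|b| ≤ N`, an inner radius `u₀` (`64/γ ≤ u₀`, `u₀ + 3/γ ≤ U`), `Rc ≥ 1`, `40π|ρ|(u₀ + 6/γ) ≤ Rc`, a free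
extraction parameter `θ′ > 0`, and the LOOP CONDITION `e₁(α₁(β₁φ₁ + β₂ξ₁) + α₂(τ₁φ₁ + τ₂ξ₁)) ≤ 1/2` on the explicit constants (abbreviation
hypotheses `hKb … hTb`; with `e^{γu₀/4} = Rc^A`, `A ≥ 3`, it holds for `Rc ≥ R₀(γ,m,ρ)`).  OUTPUT: for all `u ∈ [0,U]`,
`(1+u)⁴(a²+b²)(u) ≤ (1 + u₀ + 2/γ)⁴·T̄ + 16·Q̄`, where `T̄, Q̄` are explicit in `(γ, m, Rc, u₀, θ′, M, N)`: `Q̄ = 16M_E²/γ² + u₀⁴S₀`,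
`M_E = M + (γ²Rc/8πm)(1+u₀)²e^{−γu₀/4}N`, `S₀ = 2e₁(…)` the bootstrap output, `T̄ = τ₀ + τ₁(φ₀ + φ₁S₀) + τ₂(ξ₀ + ξ₁S₀)`.  Reading: with
`e^{γu₀/4} = Rc^A` every coefficient of `M²` is `Rc^{O(A)}·poly(u₀)` and every coefficient of `N²` carries `Rc²e^{−γu₀/2}·Rc^{O(1)}e^{3γ/(4γ)}… = Rc^{O(1)−2A+…}`
— polynomial loss in `Rc`, NO dependence on the support radius `U = R²` (the two-zone theorem of the note; the final `N² ≤ sup(1+u)⁴(a²+b²)`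
absorption and the choice `u₀ = (4A/γ)log Rc` are left to the caller).
HONEST FRAMING: an a-priori bound for ONE family of blocks of ONE linear MODEL operator of a hypothetical blow-up route (MODEL rung, negative side);
`WaistColumnGateLoc1A`, `TransverseReduction1AG/1AL` are neither proved nor refuted; nothing here bears on NS regularity.
-/

set_option linter.dupNamespace false

noncomputable section

namespace Summit.NavierStokesRegularity.NavierStokesRegularity.Theorems.DefectColumnGate

open scoped Topology
open Set Filter MeasureTheory intervalIntegral

set_option maxHeartbeats 2000000 in
/-- **Two-zone a-priori bound (symmetric column, Biot–Savart-coupled azimuthal block, `m ≥ 2`).**  See the module docstring. -/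
theorem twoZone_sup_le
    {γ m ρ Rc u₀ U M N θ' : ℝ} {Kb ME c₁ κ A₁b A₂b A₃b cΦ φ₀ φ₁ ξ₀ ξ₁ β₀ β₁ β₂ τ₀ τ₁ τ₂ e₁ α₁ α₂ S₀ Qb Tb : ℝ}
    {a a₁ b b₁ φa φa₁ φb φb₁ f₁ f₂ : ℝ → ℝ}
    (hγ : 0 < γ) (hm : 2 ≤ m) (hRc : 1 ≤ Rc) (hu₀ : 64 / γ ≤ u₀) (hu₀1 : 1 ≤ u₀) (hu₀U : u₀ + 3 / γ ≤ U) (hθ' : 0 < θ')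
    (hρ : 40 * Real.pi * |ρ| * (u₀ + 6 / γ) ≤ Rc)
    (ha : ContinuousOn a (Ici 0)) (hb : ContinuousOn b (Ici 0))
    (ha₁ : ContinuousOn a₁ (Ioi 0)) (hb₁ : ContinuousOn b₁ (Ioi 0))
    (hφa : ContinuousOn φa (Ici 0)) (hφb : ContinuousOn φb (Ici 0))
    (hf₁c : ContinuousOn f₁ (Ici 0)) (hf₂c : ContinuousOn f₂ (Ici 0))
    (hΦac : ContinuousOn (fun s => 4 * s * a₁ s + γ * s * a s) (Ici 0))
    (hΦbc : ContinuousOn (fun s => 4 * s * b₁ s + γ * s * b s) (Ici 0))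
    (hPac : ContinuousOn (fun s => s * φa₁ s) (Ici 0)) (hPbc : ContinuousOn (fun s => s * φb₁ s) (Ici 0))
    (ha0 : a 0 = 0) (hb0 : b 0 = 0) (hφa0 : φa 0 = 0) (hφb0 : φb 0 = 0)
    (hdera : ∀ u, 0 < u → HasDerivAt a (a₁ u) u) (hderb : ∀ u, 0 < u → HasDerivAt b (b₁ u) u)
    (hderφa : ∀ u, 0 < u → HasDerivAt φa (φa₁ u) u) (hderφb : ∀ u, 0 < u → HasDerivAt φb (φb₁ u) u)
    (hΦa : ∀ u, 0 < u → HasDerivAt (fun s => 4 * s * a₁ s + γ * s * a s)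
      (m ^ 2 / u * a u - m * (ρ + Rc * ((1 - Real.exp (-(γ * u / 4))) / (2 * Real.pi * u))) * b u
        + γ * m * Rc / 2 * (γ / (4 * Real.pi) * Real.exp (-(γ * u / 4))) * φb u - f₁ u) u)
    (hΦb : ∀ u, 0 < u → HasDerivAt (fun s => 4 * s * b₁ s + γ * s * b s)
      (m ^ 2 / u * b u + m * (ρ + Rc * ((1 - Real.exp (-(γ * u / 4))) / (2 * Real.pi * u))) * a u
        - γ * m * Rc / 2 * (γ / (4 * Real.pi) * Real.exp (-(γ * u / 4))) * φa u - f₂ u) u)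
    (hPa : ∀ u, 0 < u → HasDerivAt (fun s => s * φa₁ s) ((m ^ 2 / u * φa u - a u) / 4) u)
    (hPb : ∀ u, 0 < u → HasDerivAt (fun s => s * φb₁ s) ((m ^ 2 / u * φb u - b u) / 4) u)
    (hsuppa : ∀ u, U ≤ u → a u = 0) (hsuppb : ∀ u, U ≤ u → b u = 0)
    (hsuppφa : ∀ u, U ≤ u → φa u = 0) (hsuppφb : ∀ u, U ≤ u → φb u = 0)
    (hf₁ : ∀ u, 0 ≤ u → (1 + u) ^ 2 * |f₁ u| ≤ M) (hf₂ : ∀ u, 0 ≤ u → (1 + u) ^ 2 * |f₂ u| ≤ M)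
    (hNa : ∀ u, 0 < u → u * |a u| ≤ N) (hNb : ∀ u, 0 < u → u * |b u| ≤ N)
    (hIΩ : IntervalIntegrable (fun u => Real.exp (γ * u / 4)
      * ((1 - Real.exp (-(γ * u / 4))) / (2 * Real.pi * u)) * (a u ^ 2 + b u ^ 2)) volume 0 U)
    (hIE : IntervalIntegrable (fun u => Real.exp (γ * u / 4) * (a u ^ 2 + b u ^ 2)) volume 0 U)
    (hIf : IntervalIntegrable (fun u => Real.exp (γ * u / 4) * (a u * f₂ u - b u * f₁ u)) volume 0 U)
    (hIg : IntervalIntegrable (fun u => Real.exp (γ * u / 4) * (a u * f₁ u + b u * f₂ u)) volume 0 U)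
    (hID₁ : IntervalIntegrable (fun u => Real.exp (γ * u / 4) * (4 * u * (a₁ u ^ 2 + b₁ u ^ 2))) volume 0 U)
    (hID₂ : IntervalIntegrable (fun u => Real.exp (γ * u / 4) * (m ^ 2 / u * (a u ^ 2 + b u ^ 2))) volume 0 U)
    (hIaφ : IntervalIntegrable (fun u => a u * φa u) volume 0 U)
    (hIbφ : IntervalIntegrable (fun u => b u * φb u) volume 0 U)
    (hIBa₁ : IntervalIntegrable (fun u => 4 * u * φa₁ u ^ 2) volume 0 U)
    (hIBa₂ : IntervalIntegrable (fun u => m ^ 2 / u * φa u ^ 2) volume 0 U)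
    (hIBb₁ : IntervalIntegrable (fun u => 4 * u * φb₁ u ^ 2) volume 0 U)
    (hIBb₂ : IntervalIntegrable (fun u => m ^ 2 / u * φb u ^ 2) volume 0 U)
    (hIua : IntervalIntegrable (fun u => u * a u ^ 2) volume 0 U)
    (hIub : IntervalIntegrable (fun u => u * b u ^ 2) volume 0 U)
    (hIcross : IntervalIntegrable (fun u => b u * φa u - a u * φb u) volume 0 U)
    -- abbreviations (the explicit constants of the two-zone scheme)
    (hKb : Kb = 2 * Real.pi * (u₀ + 2 / γ + 4 / γ))
    (hME : ME = M + γ ^ 2 * Rc / (8 * Real.pi * m) * ((1 + u₀) ^ 2 * Real.exp (-(γ * u₀ / 4))) * N)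
    (hc₁ : c₁ = (1 - 16 / (5 * m ^ 2)) * m) (hκ : κ = γ ^ 2 * Rc / (16 * Real.pi * m))
    (hA₁b : A₁b = (u₀ + 2 / γ) * Real.exp (γ * (u₀ + 2 / γ) / 4) / Rc * (4 * Kb * ((γ + 1) * Kb + 4) / c₁ ^ 2 + 1 / 2))
    (hA₂b : A₂b = 4 * ((γ + 1) * Kb + 4) / c₁) (hA₃b : A₃b = κ * (1 + A₂b))
    (hcΦ : cΦ = 12 * ((1 + 36 * γ ^ 2) * (u₀ + 3 / γ) + 81 * γ / 32 + 81 / 64))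
    (hφ₁ : φ₁ = Real.exp (γ * (u₀ + 3 / γ) / 4) * cΦ)
    (hφ₀ : φ₀ = Real.exp (γ * (u₀ + 3 / γ) / 4) * (cΦ * (16 * ME ^ 2 / (γ ^ 2 * u₀ ^ 4)) + 243 / 8 * (ME ^ 2 / (1 + u₀) ^ 4)))
    (hξ₁ : ξ₁ = u₀ ^ 2 / 2) (hξ₀ : ξ₀ = 8 * ME ^ 2 / (γ ^ 2 * u₀ ^ 2))
    (hβ₀ : β₀ = Kb * (4 * Kb * (M ^ 2 * ((u₀ + 2 / γ) * Real.exp (γ * (u₀ + 2 / γ) / 4))) / (c₁ ^ 2 * Rc ^ 2)))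
    (hβ₁ : β₁ = Kb * (4 / (c₁ * Rc))) (hβ₂ : β₂ = Kb * (4 * κ / (c₁ * Rc)))
    (hτ₀ : τ₀ = A₁b * M ^ 2) (hτ₁ : τ₁ = A₂b + 1) (hτ₂ : τ₂ = A₃b)
    (he₁ : e₁ = Real.exp (1 / 4) / Real.exp (γ * u₀ / 4)) (hα₁ : α₁ = γ + 1 / θ') (hα₂ : α₂ = θ' / (4 * (u₀ - 1 / γ)))
    (hloop : e₁ * (α₁ * (β₁ * φ₁ + β₂ * ξ₁) + α₂ * (τ₁ * φ₁ + τ₂ * ξ₁)) ≤ 1 / 2)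
    (hS₀ : S₀ = 2 * (e₁ * (α₁ * (β₀ + β₁ * φ₀ + β₂ * ξ₀) + α₂ * (τ₀ + τ₁ * φ₀ + τ₂ * ξ₀))))
    (hQb : Qb = 16 * ME ^ 2 / γ ^ 2 + u₀ ^ 4 * S₀)
    (hTb : Tb = τ₀ + τ₁ * (φ₀ + φ₁ * S₀) + τ₂ * (ξ₀ + ξ₁ * S₀)) :
    ∀ u ∈ Icc 0 U, (1 + u) ^ 4 * (a u ^ 2 + b u ^ 2) ≤ (1 + (u₀ + 2 / γ)) ^ 4 * Tb + 16 * Qb := by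
  -- ### 0. Basic facts and restricted hypotheses
  have hπ : 0 < Real.pi := Real.pi_pos
  have hm0 : 0 < m := by linarith
  have hm0' : m ≠ 0 := hm0.ne'
  have hRc0 : 0 < Rc := by linarith
  have hℓ : 0 < 1 / γ := by positivity
  have h3γ0 : 0 < 3 / γ := by positivity
  have hu₀0 : 0 < u₀ := by linarith
  have hU : 0 < U := by linarith
  have hU0 : 0 ≤ U := hU.le
  have h2γ : 2 / γ = 2 * (1 / γ) := by ring
  have h3γ : 3 / γ = 3 * (1 / γ) := by ring
  have h4γ : 4 / γ = 4 * (1 / γ) := by ring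
  have h6γ : 6 / γ = 6 * (1 / γ) := by ring
  -- restricted hypotheses on `[0,U]`
  have haU : ContinuousOn a (Icc 0 U) := ha.mono (fun u hu => hu.1)
  have hbU : ContinuousOn b (Icc 0 U) := hb.mono (fun u hu => hu.1)
  have hφaU : ContinuousOn φa (Icc 0 U) := hφa.mono (fun u hu => hu.1)
  have hφbU : ContinuousOn φb (Icc 0 U) := hφb.mono (fun u hu => hu.1)
  have hΦacU : ContinuousOn (fun s => 4 * s * a₁ s + γ * s * a s) (Icc 0 U) := hΦac.mono (fun u hu => hu.1)
  have hΦbcU : ContinuousOn (fun s => 4 * s * b₁ s + γ * s * b s) (Icc 0 U) := hΦbc.mono (fun u hu => hu.1)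
  have hPacU : ContinuousOn (fun s => s * φa₁ s) (Icc 0 U) := hPac.mono (fun u hu => hu.1)
  have hPbcU : ContinuousOn (fun s => s * φb₁ s) (Icc 0 U) := hPbc.mono (fun u hu => hu.1)
  have ha₁U : ContinuousOn a₁ (Ioc 0 U) := ha₁.mono (fun u hu => hu.1)
  have hb₁U : ContinuousOn b₁ (Ioc 0 U) := hb₁.mono (fun u hu => hu.1)
  have hderaU : ∀ u ∈ Ioo 0 U, HasDerivAt a (a₁ u) u := fun u hu => hdera u hu.1
  have hderbU : ∀ u ∈ Ioo 0 U, HasDerivAt b (b₁ u) u := fun u hu => hderb u hu.1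
  have hderφaU : ∀ u ∈ Ioo 0 U, HasDerivAt φa (φa₁ u) u := fun u hu => hderφa u hu.1
  have hderφbU : ∀ u ∈ Ioo 0 U, HasDerivAt φb (φb₁ u) u := fun u hu => hderφb u hu.1
  have hΦaU : ∀ u ∈ Ioo 0 U, HasDerivAt (fun s => 4 * s * a₁ s + γ * s * a s)
      (m ^ 2 / u * a u - m * (ρ + Rc * ((1 - Real.exp (-(γ * u / 4))) / (2 * Real.pi * u))) * b u
        + γ * m * Rc / 2 * (γ / (4 * Real.pi) * Real.exp (-(γ * u / 4))) * φb u - f₁ u) u := fun u hu => hΦa u hu.1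
  have hΦbU : ∀ u ∈ Ioo 0 U, HasDerivAt (fun s => 4 * s * b₁ s + γ * s * b s)
      (m ^ 2 / u * b u + m * (ρ + Rc * ((1 - Real.exp (-(γ * u / 4))) / (2 * Real.pi * u))) * a u
        - γ * m * Rc / 2 * (γ / (4 * Real.pi) * Real.exp (-(γ * u / 4))) * φa u - f₂ u) u := fun u hu => hΦb u hu.1
  have hPaU : ∀ u ∈ Ioo 0 U, HasDerivAt (fun s => s * φa₁ s) ((m ^ 2 / u * φa u - a u) / 4) u := fun u hu => hPa u hu.1
  have hPbU : ∀ u ∈ Ioo 0 U, HasDerivAt (fun s => s * φb₁ s) ((m ^ 2 / u * φb u - b u) / 4) u := fun u hu => hPb u hu.1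
  have hf₁U : ∀ u ∈ Icc 0 U, (1 + u) ^ 2 * |f₁ u| ≤ M := fun u hu => hf₁ u hu.1
  have hf₂U : ∀ u ∈ Icc 0 U, (1 + u) ^ 2 * |f₂ u| ≤ M := fun u hu => hf₂ u hu.1
  -- the folded forcing `f' = f − BS` and the potential
  set cB : ℝ → ℝ := fun u => γ * m * Rc / 2 * (γ / (4 * Real.pi) * Real.exp (-(γ * u / 4))) with hcBdef
  set V : ℝ → ℝ := fun u => m * (ρ + Rc * ((1 - Real.exp (-(γ * u / 4))) / (2 * Real.pi * u))) with hVdef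
  set F₁ : ℝ → ℝ := fun u => f₁ u - cB u * φb u with hF₁def
  set F₂ : ℝ → ℝ := fun u => f₂ u + cB u * φa u with hF₂def
  have hcBc : Continuous cB := by
    simp only [hcBdef]
    fun_prop
  have hA' : ∀ u, 0 < u → HasDerivAt (fun s => 4 * s * a₁ s + γ * s * a s) (m ^ 2 / u * a u - V u * b u - F₁ u) u :=
    fun u hu => (hΦa u hu).congr_deriv (by simp only [hVdef, hF₁def, hcBdef]; ring)
  have hB' : ∀ u, 0 < u → HasDerivAt (fun s => 4 * s * b₁ s + γ * s * b s) (m ^ 2 / u * b u + V u * a u - F₂ u) u :=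
    fun u hu => (hΦb u hu).congr_deriv (by simp only [hVdef, hF₂def, hcBdef]; ring)
  -- stream coefficients `|φ| ≤ N/m²` and the folded data bound on `[u₀, ∞)`
  have hφa_bd := abs_streamCoeff_le (φ := φa) (φ₁ := φa₁) (w := a) hm0' hU hφa hφa0 hderφa hPa hNa hsuppφa
  have hφb_bd := abs_streamCoeff_le (φ := φb) (φ₁ := φb₁) (w := b) hm0' hU hφb hφb0 hderφb hPb hNb hsuppφb
  have h8 : 8 / γ ≤ 1 + u₀ := by
    have : 8 / γ ≤ 64 / γ := div_le_div_of_nonneg_right (by norm_num) hγ.le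
    linarith
  have hF₁bd : ∀ u, u₀ ≤ u → (1 + u) ^ 2 * |F₁ u| ≤ ME := by
    intro u hu
    have hu0 : 0 < u := lt_of_lt_of_le hu₀0 hu
    have h := folded_forcing_le hγ hm0 hRc0.le h8 hu (hf₁ u hu0.le) (hφb_bd u hu0.le) (-1) (Or.inr rfl)
    have e : F₁ u = f₁ u + (-1) * (γ * m * Rc / 2 * (γ / (4 * Real.pi) * Real.exp (-(γ * u / 4))) * φb u) := by
      simp only [hF₁def, hcBdef]; ring
    rw [e, hME]; exact h
  have hF₂bd : ∀ u, u₀ ≤ u → (1 + u) ^ 2 * |F₂ u| ≤ ME := by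
    intro u hu
    have hu0 : 0 < u := lt_of_lt_of_le hu₀0 hu
    have h := folded_forcing_le hγ hm0 hRc0.le h8 hu (hf₂ u hu0.le) (hφa_bd u hu0.le) 1 (Or.inl rfl)
    have e : F₂ u = f₂ u + 1 * (γ * m * Rc / 2 * (γ / (4 * Real.pi) * Real.exp (-(γ * u / 4))) * φa u) := by
      simp only [hF₂def, hcBdef]; ring
    rw [e, hME]; exact h
  -- ### 1. Exterior sup bound `Q`
  have hQext := exterior_package hγ hm0' hRc0.le hU hu₀ ha hb hφa hφb hφa0 hφb0 hdera hderb hderφa hderφb hΦa hΦb hPa hPb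
    hsuppa hsuppb hsuppφa hsuppφb (fun u hu => hf₁ u hu.le) (fun u hu => hf₂ u hu.le) hNa hNb
  have habsm : |m| = m := abs_of_pos hm0
  simp only [habsm] at hQext
  set Q : ℝ := max (16 * ME ^ 2 / γ ^ 2) (u₀ ^ 4 * (a u₀ ^ 2 + b u₀ ^ 2)) with hQdef
  have hQ : ∀ u, u₀ ≤ u → u ^ 4 * (a u ^ 2 + b u ^ 2) ≤ Q := by
    intro u hu; have := hQext u hu; rw [hQdef, hME]; exact this
  have hQ0 : 0 ≤ Q := by rw [hQdef]; exact le_trans (by positivity) (le_max_left _ _)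
  have hs_ext : ∀ u, u₀ ≤ u → a u ^ 2 + b u ^ 2 ≤ Q / u₀ ^ 4 := by
    intro u hu
    have hu0 : 0 < u := lt_of_lt_of_le hu₀0 hu
    have h1 := hQ u hu
    rw [le_div_iff₀ (by positivity)]
    have h2 : u₀ ^ 4 ≤ u ^ 4 := pow_le_pow_left₀ hu₀0.le hu 4
    have hs : 0 ≤ a u ^ 2 + b u ^ 2 := by positivity
    linarith only [h1, mul_le_mul_of_nonneg_left h2 hs]
  -- ### 2. Layer choice of `u₁` and the flux bound
  have hsubL : Icc u₀ (u₀ + 3 / γ) ⊆ Ici (0:ℝ) := fun u hu => le_trans hu₀0.le hu.1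
  have hsubL' : Icc u₀ (u₀ + 3 / γ) ⊆ Ioi (0:ℝ) := fun u hu => lt_of_lt_of_le hu₀0 hu.1
  have hF₁c : ContinuousOn F₁ (Icc u₀ (u₀ + 3 / γ)) := (hf₁c.mono hsubL).sub ((hcBc.continuousOn).mul (hφb.mono hsubL))
  have hF₂c : ContinuousOn F₂ (Icc u₀ (u₀ + 3 / γ)) := (hf₂c.mono hsubL).add ((hcBc.continuousOn).mul (hφa.mono hsubL))
  obtain ⟨u₁, hu₁, hflux⟩ := layer_flux_choice (m := m) (V := V) (f₁ := F₁) (f₂ := F₂) hγ hu₀0 (ha.mono hsubL) (hb.mono hsubL)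
    (ha₁.mono hsubL') (hb₁.mono hsubL') hF₁c hF₂c (fun u hu => hdera u (lt_trans hu₀0 hu.1)) (fun u hu => hderb u (lt_trans hu₀0 hu.1))
    (fun u hu => hA' u (lt_trans hu₀0 hu.1)) (fun u hu => hB' u (lt_trans hu₀0 hu.1))
  have hΦQ := layer_integrals_le (F₁ := F₁) (F₂ := F₂) hγ hu₀0 (ha.mono hsubL) (hb.mono hsubL) hF₁c hF₂c
    (fun u hu => hs_ext u hu.1) (fun u hu => hF₁bd u hu.1) (fun u hu => hF₂bd u hu.1)
  rw [← hcΦ] at hΦQ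
  have hu₁lo : u₀ + 1 / γ ≤ u₁ := hu₁.1
  have hu₁ub : u₁ ≤ u₀ + 2 / γ := hu₁.2
  have hu₀u₁ : u₀ ≤ u₁ := by linarith
  have hu₁0 : 0 < u₁ := lt_of_lt_of_le hu₀0 hu₀u₁
  have hu₁U : u₁ ≤ U := by linarith
  -- ### 3. Core at `u₁`, exterior feed, inner datum (raw forms, before naming)
  have hρ₁ : 40 * Real.pi * |ρ| * (u₁ + 4 / γ) ≤ Rc := by
    have h1 : u₁ + 4 / γ ≤ u₀ + 6 / γ := by linarith
    have := mul_le_mul_of_nonneg_left h1 (show 0 ≤ 40 * Real.pi * |ρ| by positivity)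
    linarith only [this, hρ]
  have hcur := coreTrunc_currencies_le hγ hm hRc hu₁0 hu₁U hρ₁ haU hbU hφaU hφbU hΦacU hΦbcU hPacU hPbcU ha0 hb0 hφa0 hφb0
    hderaU hderbU hderφaU hderφbU hΦaU hΦbU hPaU hPbU (hsuppφa U le_rfl) (hsuppφb U le_rfl) hf₁U hf₂U
    hIΩ hIE hIf hIg hID₁ hID₂ hIaφ hIbφ hIBa₁ hIBa₂ hIBb₁ hIBb₂ hIua hIub hIcross
  have hsup := coreTrunc_sup_sq_le hγ hm hRc hu₁0 hu₁U hρ₁ haU hbU ha₁U hb₁U hφaU hφbU hΦacU hΦbcU hPacU hPbcU ha0 hb0 hφa0 hφb0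
    hderaU hderbU hderφaU hderφbU hΦaU hΦbU hPaU hPbU (hsuppφa U le_rfl) (hsuppφb U le_rfl) hf₁U hf₂U
    hIΩ hIE hIf hIg hID₁ hID₂ hIaφ hIbφ hIBa₁ hIBa₂ hIBb₁ hIBb₂ hIua hIub hIcross
  rw [← hc₁, ← hκ] at hcur hsup
  have hXraw := exterior_feed_le hu₁0 hu₁U (ha.mono (fun u hu => le_trans hu₁0.le hu.1)) (hb.mono (fun u hu => le_trans hu₁0.le hu.1))
    (fun v hv => hQ v (le_trans hu₀u₁ hv.1))
  have hx0 : 0 < u₀ - 1 / γ := by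
    have h63 : (0:ℝ) < 63 / γ := by positivity
    have e : 63 / γ = 64 / γ - 1 / γ := by ring
    linarith
  have hsubI : Icc (u₀ - 1 / γ) u₀ ⊆ Ici (0:ℝ) := fun v hv => le_trans hx0.le hv.1
  have hsubIo : Icc (u₀ - 1 / γ) u₀ ⊆ Ioi (0:ℝ) := fun v hv => lt_of_lt_of_le hx0 hv.1
  have hIE1 : IntervalIntegrable (fun u => Real.exp (γ * u / 4) * (a u ^ 2 + b u ^ 2)) volume 0 u₁ :=
    hIE.mono_set (by rw [uIcc_of_le hu₁0.le, uIcc_of_le hU0]; exact Icc_subset_Icc le_rfl hu₁U)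
  have hID1 : IntervalIntegrable (fun u => Real.exp (γ * u / 4) * (4 * u * (a₁ u ^ 2 + b₁ u ^ 2))) volume 0 u₁ :=
    hID₁.mono_set (by rw [uIcc_of_le hu₁0.le, uIcc_of_le hU0]; exact Icc_subset_Icc le_rfl hu₁U)
  have hdat := datum_le_currencies hγ hx0 hu₀u₁ hθ' (ha.mono hsubI) (hb.mono hsubI) (ha₁.mono hsubIo) (hb₁.mono hsubIo)
    (fun v hv => hdera v (lt_trans hx0 hv.1)) (fun v hv => hderb v (lt_trans hx0 hv.1)) hIE1 hID1
  -- ### 4. Names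
  set B₁ : ℝ := Real.exp (γ * u₁ / 4) * (a u₁ * (4 * u₁ * b₁ u₁ + γ * u₁ * b u₁) - b u₁ * (4 * u₁ * a₁ u₁ + γ * u₁ * a u₁)) with hB₁def
  set B₂ : ℝ := Real.exp (γ * u₁ / 4) * (a u₁ * (4 * u₁ * a₁ u₁ + γ * u₁ * a u₁) + b u₁ * (4 * u₁ * b₁ u₁ + γ * u₁ * b u₁)
      - γ * u₁ * (a u₁ ^ 2 + b u₁ ^ 2)) with hB₂def
  set Φ₀ : ℝ := 4 * γ * ((1 + 36 * γ ^ 2) * (∫ u in u₀..(u₀ + 3 / γ), Real.exp (γ * u / 4) * (u * (a u ^ 2 + b u ^ 2)))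
      + 81 * γ / 32 * (∫ u in u₀..(u₀ + 3 / γ), Real.exp (γ * u / 4) * (a u ^ 2 + b u ^ 2))
      + 81 / 32 * (∫ u in u₀..(u₀ + 3 / γ), Real.exp (γ * u / 4) * |a u * F₁ u + b u * F₂ u|)) with hΦ₀def
  set X : ℝ := ∫ u in u₁..U, u * (a u ^ 2 + b u ^ 2) with hXdef
  set K : ℝ := 2 * Real.pi * (u₁ + 4 / γ) with hKdef
  set IE : ℝ := ∫ u in (0:ℝ)..u₁, Real.exp (γ * u / 4) * (a u ^ 2 + b u ^ 2) with hIEdef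
  set D : ℝ := ∫ u in (0:ℝ)..u₁, Real.exp (γ * u / 4) * (4 * u * (a₁ u ^ 2 + b₁ u ^ 2)) with hDdef
  set D₂ : ℝ := ∫ u in (0:ℝ)..u₁, Real.exp (γ * u / 4) * (m ^ 2 / u * (a u ^ 2 + b u ^ 2)) with hD₂def
  set uE : ℝ := u₁ * Real.exp (γ * u₁ / 4) with huEdef
  set s₀ : ℝ := a u₀ ^ 2 + b u₀ ^ 2 with hs₀def
  -- elementary facts on the names
  have hs₀0 : 0 ≤ s₀ := by rw [hs₀def]; positivity
  have hflux' : |B₁| + |B₂| ≤ Φ₀ := hflux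
  have hΦ₀0 : 0 ≤ Φ₀ := le_trans (by positivity) hflux'
  have hB₁le : B₁ ≤ Φ₀ := le_trans (le_abs_self _) (by linarith [hflux', abs_nonneg B₂])
  have hXQ : X ≤ Q / (2 * u₀ ^ 2) := by
    have h2 : Q / (2 * u₁ ^ 2) ≤ Q / (2 * u₀ ^ 2) := by
      apply div_le_div_of_nonneg_left hQ0 (by positivity)
      have := pow_le_pow_left₀ hu₀0.le hu₀u₁ 2
      linarith only [this]
    exact hXraw.trans h2
  have hX0 : 0 ≤ X := by
    rw [hXdef]
    exact intervalIntegral.integral_nonneg hu₁U (fun u hu => by have : 0 < u := lt_of_lt_of_le hu₁0 hu.1; positivity)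
  have hD₂0 : 0 ≤ D₂ := by
    rw [hD₂def]
    exact intervalIntegral.integral_nonneg hu₁0.le (fun u hu => by have := hu.1; positivity)
  have hc₁m : m / 5 ≤ c₁ := by
    rw [hc₁]
    have hm4 : 4 ≤ m ^ 2 := by nlinarith only [hm]
    have h45 : 16 / (5 * m ^ 2) ≤ 4 / 5 := by
      rw [div_le_iff₀ (by positivity)]; linarith only [hm4]
    have := mul_le_mul_of_nonneg_right (sub_le_sub_left h45 1) hm0.le
    linarith only [this]
  have hc₁0 : 0 < c₁ := lt_of_lt_of_le (by positivity) hc₁m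
  have hκ0 : 0 ≤ κ := by rw [hκ]; positivity
  have hKle : K ≤ Kb := by
    rw [hKdef, hKb]
    exact mul_le_mul_of_nonneg_left (by linarith only [hu₁ub]) (by positivity)
  have hK0 : 0 < K := by rw [hKdef]; positivity
  have hKb0 : 0 < Kb := lt_of_lt_of_le hK0 hKle
  have huE : uE ≤ (u₀ + 2 / γ) * Real.exp (γ * (u₀ + 2 / γ) / 4) := by
    rw [huEdef]
    have h1 := mul_le_mul_of_nonneg_left hu₁ub hγ.le
    exact mul_le_mul hu₁ub (Real.exp_le_exp.mpr (by linarith only [h1])) (Real.exp_pos _).le (by linarith)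
  have huE0 : 0 ≤ uE := by rw [huEdef]; positivity
  obtain ⟨hIEraw, hDDraw⟩ := hcur
  -- ### 5. The five bootstrap inequalities
  -- (2) currencies
  have h2boot : IE ≤ β₀ + β₁ * Φ₀ + β₂ * X := by
    have h := rebound_currency (M := M) hK0 hKle huE huE0 hc₁0 hRc0 hB₁le hΦ₀0 hκ0 hX0 hIEraw
    rw [hβ₀, hβ₁, hβ₂]; exact h
  -- (3) dissipation, and the core sup
  have h3boot : D + D₂ ≤ τ₀ + τ₁ * Φ₀ + τ₂ * X := by
    have h := rebound_dissipation (M := M) hK0 hKle huE huE0 hc₁0 hRc0 hγ hflux' hκ0 hX0 hDDraw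
    rw [hτ₀, hτ₁, hτ₂, hA₃b, hA₁b, hA₂b]
    linarith [h]
  have hcore : ∀ u ∈ Icc 0 u₁, a u ^ 2 + b u ^ 2 ≤ τ₀ + τ₁ * Φ₀ + τ₂ * X := by
    intro u hu
    have h := rebound_dissipation (M := M) hK0 hKle huE huE0 hc₁0 hRc0 hγ hflux' hκ0 hX0 (hsup u hu)
    rw [hτ₀, hτ₁, hτ₂, hA₃b, hA₁b, hA₂b]
    linarith [h]
  -- (1) the inner datum
  have h1boot : s₀ ≤ e₁ * (α₁ * IE + α₂ * (D + D₂)) := by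
    rw [he₁, hα₁, hα₂]
    have h4 : 0 ≤ Real.exp (1 / 4) / Real.exp (γ * u₀ / 4) * (θ' / (4 * (u₀ - 1 / γ))) * D₂ := by positivity
    have e : Real.exp (1 / 4) / Real.exp (γ * u₀ / 4) * ((γ + 1 / θ') * IE + θ' / (4 * (u₀ - 1 / γ)) * (D + D₂))
        = Real.exp (1 / 4) / Real.exp (γ * u₀ / 4) * ((γ + 1 / θ') * IE + θ' / (4 * (u₀ - 1 / γ)) * D)
          + Real.exp (1 / 4) / Real.exp (γ * u₀ / 4) * (θ' / (4 * (u₀ - 1 / γ))) * D₂ := by ring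
    rw [e]
    linarith [hdat, h4]
  -- (4) flux through the datum, (5) feed through the datum
  have hQle : Q ≤ 16 * ME ^ 2 / γ ^ 2 + u₀ ^ 4 * s₀ := by
    rw [hQdef]; exact max_le (le_add_of_nonneg_right (by positivity)) (le_add_of_nonneg_left (by positivity))
  have hEr0 : 0 < Real.exp (γ * (u₀ + 3 / γ) / 4) := Real.exp_pos _
  have hcΦ0 : 0 ≤ cΦ := by rw [hcΦ]; positivity
  have h4boot : Φ₀ ≤ φ₀ + φ₁ * s₀ := by
    rw [hφ₀, hφ₁]
    have h2 : cΦ * (Q / u₀ ^ 4) ≤ cΦ * (16 * ME ^ 2 / (γ ^ 2 * u₀ ^ 4)) + cΦ * s₀ := by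
      have h6 : Q / u₀ ^ 4 ≤ 16 * ME ^ 2 / (γ ^ 2 * u₀ ^ 4) + s₀ := by
        have h7 := div_le_div_of_nonneg_right hQle (pow_nonneg hu₀0.le 4)
        rw [add_div, mul_div_cancel_left₀ _ (pow_ne_zero 4 hu₀0.ne'), div_div] at h7
        exact h7
      have h8' := mul_le_mul_of_nonneg_left h6 hcΦ0
      linarith [h8']
    have h3 := mul_le_mul_of_nonneg_left (add_le_add_right h2 (243 / 8 * (ME ^ 2 / (1 + u₀) ^ 4))) hEr0.le
    linarith [hΦQ, h3]
  have h5boot : X ≤ ξ₀ + ξ₁ * s₀ := by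
    rw [hξ₀, hξ₁]
    have hu2 : (2 * u₀ ^ 2) ≠ 0 := by positivity
    have h1 : Q / (2 * u₀ ^ 2) ≤ (16 * ME ^ 2 / γ ^ 2 + u₀ ^ 4 * s₀) / (2 * u₀ ^ 2) :=
      div_le_div_of_nonneg_right hQle (by positivity)
    have e1 : u₀ ^ 4 * s₀ / (2 * u₀ ^ 2) = u₀ ^ 2 / 2 * s₀ := by
      rw [show u₀ ^ 4 * s₀ = u₀ ^ 2 / 2 * s₀ * (2 * u₀ ^ 2) by ring, mul_div_cancel_right₀ _ hu2]
    have e2 : 16 * ME ^ 2 / γ ^ 2 / (2 * u₀ ^ 2) = 8 * ME ^ 2 / (γ ^ 2 * u₀ ^ 2) := by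
      rw [div_div]; ring
    rw [add_div, e1, e2] at h1
    exact hXQ.trans h1
  -- ### 6. Bootstrap closure
  have he₁0 : 0 ≤ e₁ := by rw [he₁]; positivity
  have hα₁0 : 0 ≤ α₁ := by rw [hα₁]; positivity
  have hα₂0 : 0 ≤ α₂ := by rw [hα₂]; positivity
  have hβ₁0 : 0 ≤ β₁ := by rw [hβ₁]; positivity
  have hβ₂0 : 0 ≤ β₂ := by rw [hβ₂]; positivity
  have hA₂b0 : 0 ≤ A₂b := by rw [hA₂b]; positivity
  have hτ₁0 : 0 ≤ τ₁ := by rw [hτ₁]; positivity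
  have hτ₂0 : 0 ≤ τ₂ := by rw [hτ₂, hA₃b]; positivity
  have hboot := bootstrap_closure he₁0 hα₁0 hα₂0 hβ₁0 hβ₂0 hτ₁0 hτ₂0 hs₀0 h1boot h2boot h3boot h4boot h5boot hloop
  rw [← hS₀] at hboot
  -- ### 7. Conclusion
  have hQfin : Q ≤ Qb := by
    rw [hQb]
    have := mul_le_mul_of_nonneg_left hboot (pow_nonneg hu₀0.le 4)
    linarith [hQle]
  have hφ₁0 : 0 ≤ φ₁ := by rw [hφ₁]; positivity
  have hξ₁0 : 0 ≤ ξ₁ := by rw [hξ₁]; positivity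
  have hTfin : τ₀ + τ₁ * Φ₀ + τ₂ * X ≤ Tb := by
    rw [hTb]
    have h1 : Φ₀ ≤ φ₀ + φ₁ * S₀ := h4boot.trans (by linarith [mul_le_mul_of_nonneg_left hboot hφ₁0])
    have h2 : X ≤ ξ₀ + ξ₁ * S₀ := h5boot.trans (by linarith [mul_le_mul_of_nonneg_left hboot hξ₁0])
    linarith [mul_le_mul_of_nonneg_left h1 hτ₁0, mul_le_mul_of_nonneg_left h2 hτ₂0]
  have hT0 : 0 ≤ τ₀ + τ₁ * Φ₀ + τ₂ * X := le_trans (by positivity) (hcore 0 ⟨le_rfl, hu₁0.le⟩)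
  have hTb0 : 0 ≤ Tb := hT0.trans hTfin
  have hQb0 : 0 ≤ Qb := hQ0.trans hQfin
  intro u hu
  rcases le_or_gt u u₁ with hcase | hcase
  · -- core zone
    have h1 := hcore u ⟨hu.1, hcase⟩
    have h2 : (1 + u) ^ 4 ≤ (1 + (u₀ + 2 / γ)) ^ 4 := pow_le_pow_left₀ (by linarith [hu.1]) (by linarith) 4
    have hs : 0 ≤ a u ^ 2 + b u ^ 2 := by positivity
    calc (1 + u) ^ 4 * (a u ^ 2 + b u ^ 2) ≤ (1 + (u₀ + 2 / γ)) ^ 4 * Tb := mul_le_mul h2 (h1.trans hTfin) hs (by positivity)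
      _ ≤ (1 + (u₀ + 2 / γ)) ^ 4 * Tb + 16 * Qb := by linarith [mul_nonneg (show (0:ℝ) ≤ 16 by norm_num) hQb0]
  · -- exterior zone
    have hu' : u₀ ≤ u := le_trans hu₀u₁ hcase.le
    have hu1 : 1 ≤ u := le_trans hu₀1 hu'
    have h1 := (hQ u hu').trans hQfin
    have h2 : (1 + u) ^ 4 ≤ 16 * u ^ 4 := by
      have h3 : 1 + u ≤ 2 * u := by linarith
      have h4 := pow_le_pow_left₀ (by linarith) h3 4
      have e : (2 * u) ^ 4 = 16 * u ^ 4 := by ring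
      linarith [h4, e]
    have hs : 0 ≤ a u ^ 2 + b u ^ 2 := by positivity
    calc (1 + u) ^ 4 * (a u ^ 2 + b u ^ 2) ≤ 16 * u ^ 4 * (a u ^ 2 + b u ^ 2) := mul_le_mul_of_nonneg_right h2 hs
      _ = 16 * (u ^ 4 * (a u ^ 2 + b u ^ 2)) := by ring
      _ ≤ 16 * Qb := by linarith
      _ ≤ (1 + (u₀ + 2 / γ)) ^ 4 * Tb + 16 * Qb := by
          linarith [mul_nonneg (pow_nonneg (show (0:ℝ) ≤ 1 + (u₀ + 2 / γ) by positivity) 4) hTb0]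

end Summit.NavierStokesRegularity.NavierStokesRegularity.Theorems.DefectColumnGate

end
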